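import Summits.CriticalPhenomena.PercolationContinuityZ3.Theses.PercEventualDensity
import Summits.CriticalPhenomena.PercolationContinuityZ3.Theorems.SomeScaleDensity.Negative.ThetaPosLoadBearing
import Literature.Probability.Percolation.BernoulliPercolationProofs
import Literature.Probability.Percolation.KestenZhangTail

/-!
# Birth skeleton (BC3) for the crux `DropletSurfaceCost` (stmt-CriticalPhenomena-17921)

Route `route-CriticalPhenomena-PercEventualDensity` (sub-problem `PercolationContinuityZ3`), crux decl
`Summit.CriticalPhenomena.PercolationContinuityZ3.Theses.PercEventualDensity.DropletSurfaceCost` (rank 3, "K_d"):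
for every `p` with `θ(p) > 0` and every `A > 0` there is `δ₀ > 0` such that for all `δ ∈ (0, δ₀]` and all
large `m`, `P_p(C(0) ⊆ B_m ∧ |C(0)| ≥ δ|B_m|) ≤ exp(−A δ m²)` — confined finite droplets of small macroscopic
density cost surface order at EVERY linear rate (`B_m = box 3 m = [−m,m]³`, `C(0) = openCluster ω 0`).

## Where the crux stands (read before staffing)

* `θ(p) > 0` forces `p_c ≤ p` (`criticalProb_le_of_theta_pos'`), so the crux splits EXACTLY into the
  supercritical regime `p > p_c` — a theorem in print (Kesten–Zhang 1990 = Grimmett 1999 Thm (8.65),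
  `P_p(n ≤ |C| < ∞) ≤ exp(−η n^{2/3})`, in tree as the named fact
  `Literature.Probability.Percolation.Grimmett1999_thm_8_65`, discharged in `KestenZhangTailProofs`; rate
  `η (δ|B_m|)^{2/3} ≥ 4ηδ^{2/3} m² ≥ Aδm²` once `δ ≤ (4η/A)³`) — and the single point `p = p_c` under the
  jump hypothesis `J : θ(p_c) > 0`.
* DISPROOF USED. The standing disprover's file `Cruxes/DropletSurfaceCost/Disproof.lean` (refuter-rattack-17921,
  kernel-checked `continuity_of_dropletSurfaceCost : StripDensityLB p_c → CheapBlocking p_c → K_d → θ(p_c) = 0`;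
  paper proofs `COSTUME.md` §3) shows that the `p_c`-instance of K_d is FALSE IN EVERY JUMP WORLD: face strips
  harvest `C_∞`-mass into a dense in-box cluster at cost `exp(−O(log(1/p_c)/θ)·δm²)` (Lemma 1, every `p`; now a
  tree theorem in free-box form, `StripDensity.exists_sq_mul_rpow_le_real_freeBoxClusterGe`, p158515) and the
  box is sealed at cost `exp(−o(m²))` (Lemma 2, cheap blocking via Barsky–Grimmett–Newman; tree: blocking floor
  `eventually_exp_le_blockProb`, sandwich `blockProb_mul_real_freeBoxClusterGe_le`). Hence `K_d ⟺ θ(p_c) = 0`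
  softly: the quantifier `∀ A` is summit-strength, and NO stub of a K_d-line may assert a surface-order bound at
  an ARBITRARY (or super-constant) linear rate at a percolating `p_c` — that is the refuted strengthening. The
  sibling crux K = `FiniteClusterVolumeTail` (stmt-0943) is certified `⟺ θ(p_c) = 0` in tree
  (`finiteClusterVolumeTail_iff_percolationContinuityZ3`, p158843), so "K at p_c" (the planner's original second
  child of this crux) is a costume by a LANDED theorem and is NOT used here.
* What survives the strip construction (COSTUME.md §6): a droplet bound at SOME linear rate (`∃ A > 0`; the
  construction only kills rates above `≈ 48–384·log(1/p_c)/θ(p_c)`). That is STUB 2 below.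

## THE LINE: K_d = (Kesten–Zhang, p > p_c) + the route's own jump dichotomy at p_c

At `p_c` the only road to the `p_c`-instance of K_d is through `¬J` (costume theorem above). The skeleton takes
that road through the dichotomy the route's thesis is built on (cards free-box-shattering-is-a-branch,
dense-piece-uniqueness-hub): a jump world is either DROPLET-SHATTERED (confined dense droplets, equivalently —
by cheap blocking — macroscopic in-box density of `C(0)`, are surface-order rare at some linear rate) or it is
not; the co-crux `SomeScaleDensity` (stmt-17919) says a percolating density is never shattered (the origin's
in-box cluster is `t`-dense at infinitely many scales with positive probability); and the two are INCOMPATIBLE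
at `p_c` by an unconditional, provable lemma (quarantine sandwich in confinement form + blocking floor +
Borel–Cantelli). Four registered stubs:

* STUB 1 `stub_supercriticalDropletCost` (KNOWN, provable now, M): `p_c < p ⇒` the droplet bound at every
  linear rate. Grimmett 1999 Thm (8.65) (`Grimmett1999_thm_8_65_holds.z3`) + the exponent arithmetic
  (`rpow_two_thirds_ceil_ge` of `Theorems/PercNonProliferationFreeBoxSparseKestenZhangEdge.lean` is exactly the
  needed `δ^{2/3}(2m+1)² ≤ ⌈δ|B_m|⌉^{2/3}`) + the inclusion `{C(0) ⊆ B_m ∧ δ|B_m| ≤ |C(0)|} ⊆ {⌈δ|B_m|⌉ ≤ |C(0)| < ∞}`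
  (`Set.Finite.subset (Finset.finite_toSet _)`, `Set.Finite.cast_ncard_eq`, `Nat.ceil_le`).
* STUB 2 `stub_criticalSomeRateDropletCost` (OPEN — "a jump world is droplet-shattered"): `θ(p_c) > 0 ⇒
  ∃ A > 0 ∃ δ₀ > 0 ∀ δ ∈ (0, δ₀], ∀ large m, P_{p_c}(C(0) ⊆ B_m ∧ |C(0)| ≥ δ|B_m|) ≤ exp(−Aδm²)`. A consequence
  of the crux (`criticalSomeRate_of_crux`, A := 1) and STRICTLY WEAKER at the load-bearing quantifier; vacuous in
  the real world; NOT killed by the strip construction (its rate is a constant `O(log(1/p_c)/θ)`); refutable only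
  by exhibiting in-box density at cost `exp(−o(m²))` in a jump world (a monolithic/mosaic jump), provable only by
  excluding that. This is the honest residual content of K_d.
* STUB 3 `stub_criticalSomeScaleDensity` (OPEN — OWNED BY THE CO-CRUX stmt-17919, "a jump world is not
  shattered"): the `p_c`-instance of `SomeScaleDensity` (`criticalSomeScaleDensity_of_item`, one line). Do not
  staff separately: it closes when stmt-17919 closes.
* STUB 4 `stub_ioDensityNull_of_someRateDropletCost` (TRUE, PROVABLE NOW, L; no jump hypothesis): at `p_c`, a
  some-rate droplet bound makes "the origin's in-box cluster `{v ∈ B_m : 0 ↔ v inside B_m}` is `t`-dense at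
  infinitely many scales" a NULL event for every `t > 0`. Proof plan: confinement sandwich `u_m · P(s ≤ |K_m(0)|)
  ≤ P(C(0) ⊆ B_{2m} ∧ s ≤ |C(0)|)` (M-sized variant of `blockProb_mul_real_freeBoxClusterGe_le`: on the blocked
  annulus `(annulusCrossing 3 m)ᶜ` the cluster of `0` stays inside `B_{2m}`; independence of disjoint edge
  sets), `s = ⌈t|B_m|⌉ ≥ (t/8)|B_{2m}|`, droplet bound at `δ' = min(δ₀, t/8)` and scale `2m`:
  `≤ exp(−4Aδ'm²)`, blocking floor `u_m(p_c) ≥ exp(−Aδ'm²)` eventually (`eventually_exp_le_blockProb`, BGN), so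
  `P(t|B_m| ≤ |K_m(0)|) ≤ exp(−3Aδ'm²)` eventually — summable — and Borel–Cantelli
  (`MeasureTheory.measure_limsup_atTop_eq_zero`, `Set.mem_limsup_iff_frequently_mem` / `Filter.limsup_eq_iInf_iSup_of_nat`).

Composition (kernel-checked, no `sorry`): `DropletSurfaceCost_of : STUB 1 → STUB 2 → STUB 3 → STUB 4 → DropletSurfaceCost`
(hypotheses typed by the name-keyed aliases `__Registered.stub_*`): given `θ(p) > 0`, either `p_c < p` (STUB 1) or
`p = p_c` as points of `[0,1]`, where STUB 3 gives `t` with positive probability of i.o. density and STUB 4 ∘ STUB 2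
makes that probability `0` — absurd, so the `p_c`-instance holds (vacuously, as it must: it is refutable in every
jump world).

RE-GLUE EXHIBITED (for the tenure planner; `continuity_of_someScaleDensity_of_someRate` below, sorry-free modulo the
stubs as hypotheses): `SomeScaleDensity(p_c) ∧ STUB 2 ∧ STUB 4 ⇒ θ(p_c) = 0` DIRECTLY — the co-crux plus the
some-rate droplet bound decide the conjunct through cheap blocking + Borel–Cantelli, with none of the DERST supports
(MassPropagation needs the specific rate `150·log(1/(1−p)) + 2`, i.e. the costume quantifier; the Borel–Cantelli glue
needs only SOME rate). Recommended repair of the route: restate K_d to its some-rate form (STUB 2 at every percolating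
`p`) and re-certify `closes : SomeScaleDensity → SomeRateDropletCost → IoDensityNullOfSomeRate(support) → S`.

Honest-piece checks (proved below): STUB 1 and STUB 2 are consequences of the crux (`supercriticalDropletCost_of_crux`,
`criticalSomeRate_of_crux`); STUB 3 is the co-crux's instance (`criticalSomeScaleDensity_of_item`; in the refuter's
vocabulary `criticalSomeScaleDensity_iff_sdvConclusion`, `Iff.rfl`); STUBS 2–3 are consequences of the conjunct
(vacuity: `criticalStubs_of_continuity`), and the crux is the conjunct plus STUB 1 (`allRates_of_continuity`, stated in the unfolded form of `crux_iff`)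
— the costume, recorded as a theorem shape.

NEGATIVE LEMMAS CHECKED. This crux: `Cruxes/DropletSurfaceCost/Disproof.lean` has no `_false_without_` theorem and no
landed `Theorems/DropletSurfaceCost/Negative/*` (`ledger crux ls stmt-CriticalPhenomena-17921`, 2026-08-17); its one
refuted strengthening — a surface-order bound at EVERY linear rate at a percolating `p_c`
(`continuity_of_dropletSurfaceCost`, modulo the two paper lemmas) — is asserted by no stub (STUB 2 asks `∃ A`, STUB 1
lives at `p > p_c`). Co-crux: the landed Negative lane `Theorems/SomeScaleDensity/Negative/ThetaPosLoadBearing.lean`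
(p154176, imported) proves `someScaleDensity_false_without_thetaPos` — any proof of SDV must use `0 < θ(p)` (at `p = 0`
the conclusion fails); STUB 3 keeps exactly that hypothesis (`H = (0 < θ(p_c))` is used at STUB 3 and STUB 2, nowhere
else). Sibling crux K (stmt-0943): `finiteClusterVolumeTail_iff_percolationContinuityZ3` (p158843) — "K at `p_c`" is a
costume and is not a stub here. Negatives index (`ledger negatives --problem CriticalPhenomena`): no droplet /
in-box-density statement among the refuted items.
-/

noncomputable section

namespace Summit.CriticalPhenomena.PercolationContinuityZ3.Cruxes.DropletSurfaceCost.Birth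

open MeasureTheory Filter Literature.Probability.Percolation Literature.Probability.LatticeModels
open Summit.CriticalPhenomena.PercolationContinuityZ3.Theses.PercEventualDensity
  (DropletSurfaceCost SomeScaleDensity)

/-! ## Objects of the line -/

/-- Bond percolation on `ℤ³` at density `p`. -/
abbrev μ (p : unitInterval) : Measure (BondConfig (Site 3)) := bondPercolation (zdGraph 3) p

/-- The confined-droplet event `{C(0) ⊆ B_m ∧ δ|B_m| ≤ |C(0)|}` (spelled exactly as in the crux). -/
def droplet (δ : ℝ) (m : ℕ) : Set (BondConfig (Site 3)) :=
  {ω | openCluster ω (0 : Site 3) ⊆ ↑(box 3 m) ∧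
        δ * ((box 3 m).card : ℝ) ≤ ((openCluster ω (0 : Site 3)).ncard : ℝ)}

/-- The in-box (free-box) cluster of the origin at scale `m`, `{v ∈ B_m : 0 ↔ v inside B_m}` (the route's
`C^m(0)`, spelled exactly as in `SomeScaleDensity`). -/
def inBoxCluster (ω : BondConfig (Site 3)) (m : ℕ) : Set (Site 3) :=
  {v | v ∈ box 3 m ∧ ω ∈ openConnIn (↑(box 3 m)) 0 v}

/-- The event "the origin's in-box cluster is `t`-dense at infinitely many scales". -/
def ioDense (t : ℝ) : Set (BondConfig (Site 3)) :=
  {ω | ∃ᶠ m : ℕ in Filter.atTop, t * ((box 3 m).card : ℝ) ≤ ((inBoxCluster ω m).ncard : ℝ)}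

/-- The droplet bound at density `p` with linear rate `A`:
`∃ δ₀ > 0 ∀ δ ∈ (0, δ₀] ∃ m₀ ∀ m ≥ m₀, P_p(droplet δ m) ≤ exp(−Aδm²)`. -/
def DropletBoundAt (p : unitInterval) (A : ℝ) : Prop :=
  ∃ δ₀ : ℝ, 0 < δ₀ ∧ ∀ δ : ℝ, 0 < δ → δ ≤ δ₀ → ∃ m₀ : ℕ, ∀ m : ℕ, m₀ ≤ m →
    (μ p).real (droplet δ m) ≤ Real.exp (-(A * δ * (m : ℝ) ^ 2))

/-- Every linear rate at `p` (the crux's conclusion at one `p`). -/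
def AllRates (p : unitInterval) : Prop := ∀ A : ℝ, 0 < A → DropletBoundAt p A

/-- Some linear rate at `p` (the residue that survives the strip construction). -/
def SomeRate (p : unitInterval) : Prop := ∃ A : ℝ, 0 < A ∧ DropletBoundAt p A

/-- The crux is literally `∀ p, θ(p) > 0 → AllRates p`. -/
theorem crux_iff :
    DropletSurfaceCost ↔ ∀ p : unitInterval, 0 < theta (zdGraph 3) (0 : Site 3) p → AllRates p :=
  Iff.rfl

theorem allRates_someRate {p : unitInterval} (h : AllRates p) : SomeRate p := ⟨1, one_pos, h 1 one_pos⟩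

/-! ## The four stub statements -/

/-- STUB 1 statement (the supercritical regime, a theorem in print): `p_c < p ⇒ AllRates p`. -/
def SupercriticalDropletCost : Prop :=
  ∀ p : unitInterval, criticalProb (zdGraph 3) (0 : Site 3) < (p : ℝ) → AllRates p

/-- STUB 2 statement: a jump world is droplet-shattered — `θ(p_c) > 0 ⇒ SomeRate p_c`. -/
def CriticalSomeRateDropletCost : Prop :=
  0 < theta (zdGraph 3) (0 : Site 3) (criticalProbI 3) → SomeRate (criticalProbI 3)

/-- STUB 3 statement: the `p_c`-instance of the co-crux `SomeScaleDensity` — a jump world is not shattered. -/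
def CriticalSomeScaleDensity : Prop :=
  0 < theta (zdGraph 3) (0 : Site 3) (criticalProbI 3) →
    ∃ t : ℝ, 0 < t ∧ 0 < (μ (criticalProbI 3)).real (ioDense t)

/-- STUB 4 statement (no jump hypothesis): at `p_c`, a some-rate droplet bound makes i.o. macroscopic in-box
density of `C(0)` a null event. -/
def IoDensityNullOfSomeRate : Prop :=
  SomeRate (criticalProbI 3) → ∀ t : ℝ, 0 < t → (μ (criticalProbI 3)).real (ioDense t) = 0

/-! ## Registered stubs
The four `stub_*` theorems are stated UNFOLDED over tree declarations only (a `Theorems/` file, which cannot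
import this crux workfile, must be able to prove the identical signature); each is definitionally the
corresponding statement above (`example`s after the block). -/

/-- **STUB 1 `supercriticalDropletCost`** (KNOWN; provable now, M): for `p > p_c(ℤ³)` and every `A > 0` there
is `δ₀ > 0` with `P_p(C(0) ⊆ B_m ∧ |C(0)| ≥ δ|B_m|) ≤ exp(−Aδm²)` for `δ ∈ (0, δ₀]`, `m` large. Kesten–Zhang
1990 = Grimmett 1999 Thm (8.65) (`Grimmett1999_thm_8_65_holds.z3`: `P_p(n ≤ |C(0)| < ∞) ≤ exp(−η n^{2/3})`,
`n ≥ 1`) with `n = ⌈δ|B_m|⌉`, `η n^{2/3} ≥ η δ^{2/3}(2m+1)² ≥ 4ηδ^{2/3}m² ≥ Aδm²` for `δ ≤ δ₀ := (4η/A)³`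
(`rpow_two_thirds_ceil_ge`), and `{C(0) ⊆ B_m ∧ δ|B_m| ≤ |C(0)|} ⊆ {n ≤ |C(0)| ∧ C(0) finite}`. -/
theorem stub_supercriticalDropletCost :
    ∀ p : unitInterval, criticalProb (zdGraph 3) (0 : Site 3) < (p : ℝ) →
      ∀ A : ℝ, 0 < A → ∃ δ₀ : ℝ, 0 < δ₀ ∧ ∀ δ : ℝ, 0 < δ → δ ≤ δ₀ → ∃ m₀ : ℕ, ∀ m : ℕ, m₀ ≤ m →
        (bondPercolation (zdGraph 3) p).real
            {ω | openCluster ω (0 : Site 3) ⊆ ↑(box 3 m) ∧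
                  δ * ((box 3 m).card : ℝ) ≤ ((openCluster ω (0 : Site 3)).ncard : ℝ)} ≤
          Real.exp (-(A * δ * (m : ℝ) ^ 2)) := by
  sorry

/-- **STUB 2 `criticalSomeRateDropletCost`** (OPEN — a jump world is droplet-shattered): if `θ(p_c) > 0` then
for SOME `A > 0` there is `δ₀ > 0` with `P_{p_c}(C(0) ⊆ B_m ∧ |C(0)| ≥ δ|B_m|) ≤ exp(−Aδm²)` for `δ ∈ (0, δ₀]`,
`m` large. Consequence of the crux (`A := 1`); vacuous in the real world; the strip construction of
`Disproof.lean` refutes only rates `A ≳ log(1/p_c)/θ(p_c)` (COSTUME.md §6: "∃ A evades the construction").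
Why it might fail: a monolithic or mosaic jump world (in-box giant pieces with probability `exp(−o(m²))`) makes
droplets cost `exp(−o(m²))` by cheap blocking; nothing in print excludes it at the same density (every
surface-order large-deviation proof uses a slab percolating at `p` or sprinkling: KZ90, Pisztora 1996, DERST 2026
Thm 2); barrier `SprinklingRenormalisation` is met head-on here, and `SameDensityLocalUniqueness` forbids any
proof through rare bad blocks with linear-scale local uniqueness. -/
theorem stub_criticalSomeRateDropletCost :
    0 < theta (zdGraph 3) (0 : Site 3) (criticalProbI 3) →
      ∃ A : ℝ, 0 < A ∧ ∃ δ₀ : ℝ, 0 < δ₀ ∧ ∀ δ : ℝ, 0 < δ → δ ≤ δ₀ → ∃ m₀ : ℕ, ∀ m : ℕ, m₀ ≤ m →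
        (bondPercolation (zdGraph 3) (criticalProbI 3)).real
            {ω | openCluster ω (0 : Site 3) ⊆ ↑(box 3 m) ∧
                  δ * ((box 3 m).card : ℝ) ≤ ((openCluster ω (0 : Site 3)).ncard : ℝ)} ≤
          Real.exp (-(A * δ * (m : ℝ) ^ 2)) := by
  sorry

/-- **STUB 3 `criticalSomeScaleDensity`** (OPEN — the `p_c`-instance of the co-crux `SomeScaleDensity`,
stmt-CriticalPhenomena-17919; closes with it, `criticalSomeScaleDensity_of_item`): if `θ(p_c) > 0` then for some
`t > 0`, with positive `P_{p_c}`-probability the origin's in-box cluster `{v ∈ B_m : 0 ↔ v inside B_m}` has at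
least `t|B_m|` vertices for infinitely many `m`. A theorem for `p > p_c` (Pisztora 1996); at a percolating
`p_c` it is the negation of the SHATTERED jump branch. Why it might fail: the shattered weaver (stationary,
finite energy, unique dense infinite cluster whose in-box pieces are all sparse) violates it, so no soft proof
exists (route header, crux 17919). -/
theorem stub_criticalSomeScaleDensity :
    0 < theta (zdGraph 3) (0 : Site 3) (criticalProbI 3) →
      ∃ t : ℝ, 0 < t ∧
        0 < (bondPercolation (zdGraph 3) (criticalProbI 3)).real
              {ω | ∃ᶠ m : ℕ in Filter.atTop,
                t * ((box 3 m).card : ℝ) ≤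
                  (({v | v ∈ box 3 m ∧ ω ∈ openConnIn (↑(box 3 m)) 0 v} : Set (Site 3)).ncard : ℝ)} := by
  sorry

/-- **STUB 4 `ioDensityNull_of_someRateDropletCost`** (TRUE, PROVABLE NOW, L; no jump hypothesis): at
`p = p_c(ℤ³)`, if confined droplets obey a some-rate bound (`∃ A > 0 ∃ δ₀ > 0 ∀ δ ∈ (0,δ₀] ∀ large m,
P(C(0) ⊆ B_m ∧ |C(0)| ≥ δ|B_m|) ≤ exp(−Aδm²)`), then for every `t > 0` the event "the origin's in-box cluster is
`t`-dense at infinitely many scales" is `P_{p_c}`-null. Plan: confinement sandwich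
`u_m(p_c)·P(s ≤ |K_m(0)|) ≤ P(C(0) ⊆ B_{2m} ∧ s ≤ |C(0)|)` (variant of `blockProb_mul_real_freeBoxClusterGe_le`),
`s = ⌈t|B_m|⌉ ≥ (t/8)|B_{2m}|`, droplet bound at `δ' = min(δ₀, t/8)`, scale `2m` (`≤ exp(−4Aδ'm²)`), blocking
floor `u_m(p_c) ≥ exp(−Aδ'm²)` eventually (`eventually_exp_le_blockProb`, Barsky–Grimmett–Newman 1991), hence
`P(t|B_m| ≤ |K_m(0)|) ≤ exp(−3Aδ'm²)` eventually, summable; Borel–Cantelli (`measure_limsup_atTop_eq_zero`). -/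
theorem stub_ioDensityNull_of_someRateDropletCost :
    (∃ A : ℝ, 0 < A ∧ ∃ δ₀ : ℝ, 0 < δ₀ ∧ ∀ δ : ℝ, 0 < δ → δ ≤ δ₀ → ∃ m₀ : ℕ, ∀ m : ℕ, m₀ ≤ m →
        (bondPercolation (zdGraph 3) (criticalProbI 3)).real
            {ω | openCluster ω (0 : Site 3) ⊆ ↑(box 3 m) ∧
                  δ * ((box 3 m).card : ℝ) ≤ ((openCluster ω (0 : Site 3)).ncard : ℝ)} ≤
          Real.exp (-(A * δ * (m : ℝ) ^ 2))) →
      ∀ t : ℝ, 0 < t →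
        (bondPercolation (zdGraph 3) (criticalProbI 3)).real
            {ω | ∃ᶠ m : ℕ in Filter.atTop,
              t * ((box 3 m).card : ℝ) ≤
                (({v | v ∈ box 3 m ∧ ω ∈ openConnIn (↑(box 3 m)) 0 v} : Set (Site 3)).ncard : ℝ)} = 0 := by
  sorry

/-- `stub_supercriticalDropletCost` is definitionally `SupercriticalDropletCost`. -/
example : SupercriticalDropletCost := stub_supercriticalDropletCost
/-- `stub_criticalSomeRateDropletCost` is definitionally `CriticalSomeRateDropletCost`. -/
example : CriticalSomeRateDropletCost := stub_criticalSomeRateDropletCost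
/-- `stub_criticalSomeScaleDensity` is definitionally `CriticalSomeScaleDensity`. -/
example : CriticalSomeScaleDensity := stub_criticalSomeScaleDensity
/-- `stub_ioDensityNull_of_someRateDropletCost` is definitionally `IoDensityNullOfSomeRate`. -/
example : IoDensityNullOfSomeRate := stub_ioDensityNull_of_someRateDropletCost

/-! ### Name-keyed aliases of the stub statements
`__Registered.stub_X` is statement `X` under the registered stub's short name, so that the native skeleton
audit (`#h21_check_skeleton`: hypotheses admissible iff registered obligations / declared stubs BY NAME)
accepts `DropletSurfaceCost_of : __Registered.stub_… → … → DropletSurfaceCost`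
(device of `Cruxes/FiniteClusterMomentsOfTheta/Lines/birth.lean`; the `@[stub]` attribute is gate-reserved). -/
namespace __Registered

/-- Alias of `SupercriticalDropletCost` keyed by the registered stub name. -/
abbrev stub_supercriticalDropletCost : Prop := SupercriticalDropletCost
/-- Alias of `CriticalSomeRateDropletCost` keyed by the registered stub name. -/
abbrev stub_criticalSomeRateDropletCost : Prop := CriticalSomeRateDropletCost
/-- Alias of `CriticalSomeScaleDensity` keyed by the registered stub name. -/
abbrev stub_criticalSomeScaleDensity : Prop := CriticalSomeScaleDensity
/-- Alias of `IoDensityNullOfSomeRate` keyed by the registered stub name. -/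
abbrev stub_ioDensityNull_of_someRateDropletCost : Prop := IoDensityNullOfSomeRate

end __Registered

/-! ## Proved plumbing -/

/-- `θ(p) > 0 ⇒ p_c ≤ p` (`θ = 0` below `p_c`, Grimmett 1999 (1.11); tree:
`theta_eq_zero_of_lt_criticalProb_holds`). -/
theorem criticalProb_le_of_theta_pos' {p : unitInterval} (h : 0 < theta (zdGraph 3) (0 : Site 3) p) :
    criticalProb (zdGraph 3) (0 : Site 3) ≤ (p : ℝ) := by
  by_contra hle
  exact h.ne' (theta_eq_zero_of_lt_criticalProb_holds (zdGraph 3) (0 : Site 3) p (not_le.mp hle))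

/-- The regime split: a percolating `p` is either the critical point itself or strictly supercritical. -/
theorem eq_criticalProbI_or_lt {p : unitInterval} (h : 0 < theta (zdGraph 3) (0 : Site 3) p) :
    p = criticalProbI 3 ∨ criticalProb (zdGraph 3) (0 : Site 3) < (p : ℝ) := by
  rcases (criticalProb_le_of_theta_pos' h).eq_or_lt with heq | hlt
  · exact Or.inl (Subtype.ext (by rw [coe_criticalProbI]; exact heq.symm))
  · exact Or.inr hlt

/-! ## Honest pieces (where each stub sits) -/

/-- STUB 1 is a consequence of the crux (`p > p_c ⇒ θ(p) > 0`, `theta_pos_of_criticalProb_lt_holds`). -/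
theorem supercriticalDropletCost_of_crux (h : DropletSurfaceCost) : SupercriticalDropletCost :=
  fun p hp => h p (theta_pos_of_criticalProb_lt_holds (zdGraph 3) (0 : Site 3) p hp)

/-- STUB 2 is a consequence of the crux (`A := 1`): it is a WEAKENING of the `p_c`-instance. -/
theorem criticalSomeRate_of_crux (h : DropletSurfaceCost) : CriticalSomeRateDropletCost :=
  fun hθ => allRates_someRate (h (criticalProbI 3) hθ)

/-- STUB 3 is the `p_c`-instance of the co-crux `SomeScaleDensity` (stmt-CriticalPhenomena-17919). -/
theorem criticalSomeScaleDensity_of_item (h : SomeScaleDensity) : CriticalSomeScaleDensity :=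
  fun hθ => h (criticalProbI 3) hθ

/-- STUB 3 in the vocabulary of the co-crux's landed Negative lane (`ThetaPosLoadBearing.lean`, p154176): it is
`0 < θ(p_c) → SDVConclusion p_c`, keeping the hypothesis that `someScaleDensity_false_without_thetaPos` shows to
be load-bearing. -/
theorem criticalSomeScaleDensity_iff_sdvConclusion :
    CriticalSomeScaleDensity ↔
      (0 < theta (zdGraph 3) (0 : Site 3) (criticalProbI 3) →
        Summit.CriticalPhenomena.PercolationContinuityZ3.Theorems.SomeScaleDensity.Negative.SDVConclusion
          (criticalProbI 3)) :=
  Iff.rfl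

/-- The obstruction honoured: without `0 < θ(p)` the co-crux's conclusion fails (at `p = 0`), so a `θ`-free
STUB 3 ranging over all `p` would be refuted — recorded from the landed lemma. -/
example : ¬ ∀ p : unitInterval,
    Summit.CriticalPhenomena.PercolationContinuityZ3.Theorems.SomeScaleDensity.Negative.SDVConclusion p :=
  Summit.CriticalPhenomena.PercolationContinuityZ3.Theorems.SomeScaleDensity.Negative.someScaleDensity_false_without_thetaPos

/-- STUBS 2 and 3 are consequences of the conjunct (their hypothesis `θ(p_c) > 0` is then absurd). -/
theorem criticalStubs_of_continuity (hS : _root_.PercolationContinuityZ3) :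
    CriticalSomeRateDropletCost ∧ CriticalSomeScaleDensity := by
  have h0 : theta (zdGraph 3) (0 : Site 3) (criticalProbI 3) = 0 := percolationContinuityZ3_iff.mp hS
  exact ⟨fun hθ => absurd h0 hθ.ne', fun hθ => absurd h0 hθ.ne'⟩

/-- **Re-glue exhibited by the skeleton** (for the tenure planner): the `p_c`-instance of the co-crux
`SomeScaleDensity`, the some-rate droplet bound (STUB 2) and the provable incompatibility (STUB 4) already decide
the conjunct — no DERST support, no slab, no DST. -/
theorem continuity_of_someScaleDensity_of_someRate (hsdv : CriticalSomeScaleDensity)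
    (hsome : CriticalSomeRateDropletCost) (hnull : IoDensityNullOfSomeRate) :
    _root_.PercolationContinuityZ3 := by
  rw [show _root_.PercolationContinuityZ3 ↔ theta (zdGraph 3) (0 : Site 3) (criticalProbI 3) = 0 from
    percolationContinuityZ3_iff]
  by_contra hne
  have hθ : 0 < theta (zdGraph 3) (0 : Site 3) (criticalProbI 3) :=
    lt_of_le_of_ne measureReal_nonneg (Ne.symm hne)
  obtain ⟨t, ht, hpos⟩ := hsdv hθ
  exact absurd (hnull (hsome hθ) t ht) hpos.ne'

/-! ## The composition, by name -/

/-- **`DropletSurfaceCost_of`**: the four registered stubs imply the crux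
`Summit.CriticalPhenomena.PercolationContinuityZ3.Theses.PercEventualDensity.DropletSurfaceCost`
(kernel-checked; no `sorry` outside the stubs). Regime split at `p_c`; the `p_c`-branch goes through `¬J`. -/
theorem DropletSurfaceCost_of (hsup : __Registered.stub_supercriticalDropletCost)
    (hsome : __Registered.stub_criticalSomeRateDropletCost)
    (hsdv : __Registered.stub_criticalSomeScaleDensity)
    (hnull : __Registered.stub_ioDensityNull_of_someRateDropletCost) :
    Summit.CriticalPhenomena.PercolationContinuityZ3.Theses.PercEventualDensity.DropletSurfaceCost := by
  intro p hθ
  rcases eq_criticalProbI_or_lt hθ with rfl | hlt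
  · obtain ⟨t, ht, hpos⟩ := hsdv hθ
    exact absurd (hnull (hsome hθ) t ht) hpos.ne'
  · exact hsup p hlt

/-- Wiring check: the registered stubs feed `DropletSurfaceCost_of` as stated. -/
example : Summit.CriticalPhenomena.PercolationContinuityZ3.Theses.PercEventualDensity.DropletSurfaceCost :=
  DropletSurfaceCost_of stub_supercriticalDropletCost stub_criticalSomeRateDropletCost
    stub_criticalSomeScaleDensity stub_ioDensityNull_of_someRateDropletCost

/-- The COSTUME shape, recorded: the crux (in the unfolded form of `crux_iff`, so that this file has exactly
one theorem concluding the crux decl BY NAME — the skeleton `DropletSurfaceCost_of`) follows from the conjunct and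
STUB 1 alone (Kesten–Zhang above `p_c`; at `p_c` the hypothesis `θ(p_c) > 0` is absurd). Together with
`Disproof.continuity_of_dropletSurfaceCost` (crux ⇒ conjunct, modulo two paper lemmas) this is `K_d ⟺ θ(p_c) = 0`. -/
theorem allRates_of_continuity (hsup : SupercriticalDropletCost) (hS : _root_.PercolationContinuityZ3) :
    ∀ p : unitInterval, 0 < theta (zdGraph 3) (0 : Site 3) p → AllRates p := by
  intro p hθ
  rcases eq_criticalProbI_or_lt hθ with rfl | hlt
  · exact absurd (percolationContinuityZ3_iff.mp hS) hθ.ne'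
  · exact hsup p hlt

end Summit.CriticalPhenomena.PercolationContinuityZ3.Cruxes.DropletSurfaceCost.Birth

end
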